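import Mathlib.Tactic.Linarith
import Mathlib.Tactic.Ring
import Mathlib.Tactic.NormNum
import HarnessLib

/-!
# The (0,1) cell of the ι-window, EXISTENCE side, IX — ADDENDUM B: the local index at an A₁ base point
# (arithmetic skeleton of `H2-EXISTENCE-SIDE-9.md` §B)

Family `hodge`, b2b cell `hweil`, `Summits/HodgeConjecture/HodgeConjecture/Theorems` (helper of item stmt-HodgeConjecture-2524). Companion to
`WeilTypeLadderH2W2CornerNine.lean` (pv3-g16, [IX] §§2–3 and ADDENDUM A) with the SAME dictionary; kept in a separate file only because the ADDENDUM A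
append to that file (p205741) was still in the gate queue when this was written. Report `run/shared/lean/b2b/hodge-weil/b2b-hweil-pv3-g16/
H2-EXISTENCE-SIDE-9.md` §B. Def-free, fully proved ELEMENTARY statement (integer bookkeeping); the module theory is in the docstring and the report.
HONEST FRAMING: a census / structure result about one cell of the ladder's H2 test on the existence side, on the Jacobian locus only; no case of the
Hodge conjecture is proved; nothing here is a rung; no statement of [Markman 2025] is used; nothing here depends on (LP) or on 'ker ob = ann(ch)'.

LEMMA B.1: at a fixed point `x ∈ J[2]` on the pinching curve, with `Θ_{±b}` smooth at `x` and `S_b` having an ordinary double point there, the local index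
of the saturated corner sheaf is `t_x(F̂) = t(N₁, T)` (the hull part `θ₋L₁ ⊕ θ₊L₂` is an induced representation) and equals `0` if `N₁,x` is free, `±8`
if not: `t(𝒪_S) = 0` (Koszul on one odd and one even equation), an ι-stable smooth non-Cartier curve germ `ℓ ⊂ S_b` through `x` exists (odd arc) with
`t(𝒪_ℓ) = 8` (Koszul on three odd equations), and `0 → I_ℓ → 𝒪_S → 𝒪_ℓ → 0` gives `t(I_ℓ) = −8`. COROLLARY B.2: H2's `t_x(F) = 0` and the junk index
`16(n₊ − n₋)` force `N₁` FREE at EVERY fixed base point (no hypothesis on the other fixed points, sharpening [VIII] 8.3). Consequences (B.3–B.8 of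
the report): the strata (G1) 'two fixed points' and (G3) '(Θ + x) ∩ N_tan' carry no junk-carrying (0,1) object at `j = 0`, and the configurations of
record are clean at every fixed point. 0 unconditional rungs above the floor.
-/

set_option linter.dupNamespace false

namespace Summit.HodgeConjecture.HodgeConjecture.WeilTypeLadder

section H2W2CornerNineIndex

/-- [IX] LEMMA B.1 / COROLLARY B.2: Koszul traces. For `𝒪_S = R/(o, e)` (`o` odd, `e` even): `Tor = (k₊; k₋ ⊕ k₊; k₋)`, alternating trace
`1 − (−1 + 1) + (−1) = 0`; for an ι-stable smooth curve germ with three odd equations: `tr(ι | Λ^i k₋³) = (−1)^i·C(3,i)`, alternating sum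
`1 + 3 + 3 + 1 = 8`; hence `t(I_ℓ) = t(𝒪_S) − t(𝒪_ℓ) = 0 − 8 = −8` and `t(N₁) ∈ {0, 8, −8}`; the skyscrapers have `t(k_±) = ±(1 + 4 + 6 + 4 + 1) = ±16`, so a
junk module has index `16(n₊ − n₋)`, and `t_x(F̂) = t_x(F) + 16(n₊ − n₋)` with `t_x(F) = 0` is divisible by `16` — which excludes `±8`: `N₁` is free and
`n₊ = n₋`. Consistency with [VIII] 8.3: `8εd` for `d ∈ {0, 1}`, `ε = ±1` takes the same values `{0, ±8}`; and the A₃ example of [IX] B.5 (iii): Koszul on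
(odd, odd, even) gives `1 − (−1 − 1 + 1) + (1 − 1 − 1) − 1 = 0`. [§B.1–B.2, B.5] -/
theorem local_index_base_point (np nm : ℤ) (ε d : ℤ) (hε : ε = 1 ∨ ε = -1) (hd : d = 0 ∨ d = 1) :
    ((1 : ℤ) - (-1 + 1) + (-1) = 0) ∧ ((1 : ℤ) + 3 + 3 + 1 = 8) ∧ ((0 : ℤ) - 8 = -8) ∧ ((1 : ℤ) + 4 + 6 + 4 + 1 = 16) ∧
    (¬ (16 : ℤ) ∣ 8 ∧ ¬ (16 : ℤ) ∣ -8) ∧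
    (∀ t : ℤ, (t = 0 ∨ t = 8 ∨ t = -8) → t = 0 + 16 * (np - nm) → (t = 0 ∧ np = nm)) ∧
    (8 * ε * d = 0 ∨ 8 * ε * d = 8 ∨ 8 * ε * d = -8) ∧
    ((1 : ℤ) - (-1 - 1 + 1) + (1 - 1 - 1) - 1 = 0) := by
  refine ⟨by norm_num, by norm_num, by norm_num, by norm_num, ⟨by decide, by decide⟩, ?_, ?_, by norm_num⟩
  · intro t ht h; rcases ht with rfl | rfl | rfl <;> omega
  · rcases hε with rfl | rfl <;> rcases hd with rfl | rfl <;> norm_num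

end H2W2CornerNineIndex

end Summit.HodgeConjecture.HodgeConjecture.WeilTypeLadder
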